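import Summits.Ventures.CertifiedManyBodySolver.Rows.CARPolyWindowGramTBRows
import Summits.Ventures.CertifiedManyBodySolver.Rows.CorrWindowBoxHamiltonian
import Summits.Ventures.CertifiedManyBodySolver.Rows.CorrWindowCertDictionaryEnergy
import Summits.Ventures.CertifiedManyBodySolver.Downfold.TPrimePinnedPairRowKernelBox
import HarnessLib

/-!
# The single-vertex closer AT BOX GEOMETRY: every geometry, table, dictionary and licensing hypothesis of `…TBRowsHalfAuto` discharged BY
# NAME on `boxQuot r R vmax` — an instance passes its data, its chain record and ONE inequality

HONEST FRAMING: Lean plumbing towards «tier P» (cell hubbard-obs; captain R-g4-5 «the closer call with the geometry binders stays the PROVER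
seat's»; the W3 instance `Certificates/HubRm2uTierP/*` of hubbard-algo-p2 ends in an `Assembly` module with `chain_ok : ChainQAOK D 2048 350 Cs
slices Hs`, `D := boxQuot 6 13 7`, `TH := hamTermsBox 13 1 tp U`, `TE := energyTermsIdx 1 tp U (boxIx 13)`, `o σ := orb (boxIx 13 0) σ`, Gram
`gramTBRowsHalf 40 blocks`, eom masks `autoMasks`). This file turns that record + `q ≤ lowerConst (decPoly N C_M) + (Σμ)(n₀/2 − ν)` into
`SquareTTPrimeCorrAffineOrbitLowerRowN tp U q hi lo κhi κlo s n₀ univ (boxW R) (termOp (boxD R) TX)` with NO geometry left to the instance: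
`affineOrbitLowerRowN_of_chainTBRowsHalfAuto_box r R vmax (hrR : r + 1 ≤ R) (hv : r + vmax ≤ R)` takes the instance's OWN constants `D TH TE o`
with `rfl`-equations to the box forms (robust against unfolding), the certificate scalars, `blocks`, `EB`, `CW` (+ the charge side condition,
vacuous for `CW = []`), `AV`, `ns`, `M`, `Cs`, `Hs`, the chain record and the inequality. Licensed symmetry set `S = univ` (all eight `D₄`
codes; `boxOk vmax` licenses shifts `‖v‖∞ ≤ vmax`, inside the window by `box_hokV`). Also the full-row twin `…_of_chainTBRowsAuto_box`
(`gramTBRows`, closer `…GAuto`). Box helper facts reused BY NAME from hubbard-cov-la214-unc-2's `Downfold/TPrimePinnedPairRowKernelBox.lean`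
(`thicken01_subset_boxW`, `thicken_boxW_subset_boxW`, `boxD_orb_boxIx_zero`). Nothing of record; no certificate evaluated here; CONTROL/CALIBRATION context (wording (xx1)); silent on
the presence of superconductivity; not a `T_c` or phase sentence; nothing about any material; no summit statement is proved by this file.
Seat hubbard-obs-p2 (STIFFNESS), `prover-hubbard-obs-p2-g24-0`, zero compute.

References: X. Han, arXiv:2006.06002 §3 [Han2020Bootstrap]; J. Wang et al., PRX 14 (2024) 031006 §III [WangEtAl2024]; C. Jansson, D. Chaykin,
C. Keil, SIAM J. Numer. Anal. 46 (2008) 180 [JanssonChaykinKeil2008].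
-/

namespace Summit.Ventures.CertifiedManyBodySolver

namespace CARPolyWindow

open Summit.Ventures.CertifiedQuantumChemistry Summit.Ventures.CertifiedQuantumChemistry.CARPoly
open Literature.MathematicalPhysics.QuantumLattice Literature.MathematicalPhysics.QuantumLattice.HubbardWave0
open Literature.MathematicalPhysics.QuantumManyBody.StateRelaxation
open Literature.Probability.LatticeModels ThermodynamicLimit Filter Topology
open Matrix BoxGeom
open Summit.Ventures.CertifiedManyBodySolver.Downfold (thicken01_subset_boxW boxD_orb_boxIx_zero thicken_boxW_subset_boxW)
open scoped ComplexOrder BigOperators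

noncomputable section BoxCloser

/-- **SINGLE-VERTEX CLOSER AT BOX GEOMETRY, HALF-ROW GRAM, KERNEL EOM MASKS**: instance constants `D TH TE o` (with `rfl` equations to
`boxQuot r R vmax` / `hamTermsBox R 1 tp U` / `energyTermsIdx 1 tp U (boxIx R)` / `orb (boxIx R 0)`), scalars, `blocks`, `EB`, `CW`, `AV`,
`ns`, `M`, `Cs`, `Hs`, the chain record, ONE inequality ⇒ the affine-N orbit-lower row on `boxW R` with `S = univ`.
[cite: WangEtAl2024, §III] [cite: Han2020Bootstrap, §3] [cite: JanssonChaykinKeil2008, §3] -/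
theorem affineOrbitLowerRowN_of_chainTBRowsHalfAuto_box (r R vmax : ℕ) (hrR : r + 1 ≤ R) (hv : r + vmax ≤ R)
    (tp U : ℚ) (hU : 0 ≤ U) (Bkey : ℕ)
    (D : QuotData (boxN R) (boxN r)) (hD : D = boxQuot r R vmax)
    (TH : Terms (Orb (Fin (boxN R)))) (hTH : TH = hamTermsBox R 1 tp U)
    (TE : Terms (Orb (Fin (boxN R)))) (hTE : TE = energyTermsIdx 1 tp U (boxIx R))
    (o : Fin 2 → Orb (Fin (boxN R))) (ho : o = fun σ => orb (boxIx R 0) σ)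
    (TX : Terms (Orb (Fin (boxN R)))) (μ : Fin 2 → ℚ) (ν κhi hi κlo lo : ℚ) (K : ℕ)
    (blocks : List (List (List ℤ × Terms (Orb (Fin (boxN R)))))) (EB : List (Terms (Orb (Fin (boxN r)))))
    (CW : Terms (Orb (Fin (boxN R)))) (hcw : ∀ wc ∈ CW, chargeW wc.1 ≠ 0 ∨ spinChargeW (fun p => (ofLex p).2) wc.1 ≠ 0)
    (AV : List (Terms (Orb (Fin (boxN R)))))
    (ns : List ℕ) (M : ℕ) (Cs : List SOSDual.EncPoly) (hC0 : Cs.getD 0 [] = []) (Hs : List (List (QHint (boxN r))))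
    (hchain : ChainQAOK D Bkey M Cs
      (groupSlices (residTGslicesNear TX μ ν o κhi hi κlo lo TE (gramTBRowsHalf K blocks) TH D.f EB (autoMasks TH D.f EB)
        (fun l : Fin 0 => l.elim0) (fun l : Fin 0 => l.elim0) CW AV) ns) Hs)
    {q s n₀ : ℚ} (hs : s = (μ 0 + μ 1) / 2)
    (hq : haveI := neZero_boxN R; q ≤ lowerConst (SOSDual.decPoly (boxN R) (Cs.getD M [])) + (μ 0 + μ 1) * (n₀ / 2 - ν)) :
    SquareTTPrimeCorrAffineOrbitLowerRowN (tp : ℝ) (U : ℝ) q hi lo κhi κlo s n₀ Finset.univ (boxW R) (termOp (boxD R) TX) := by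
  haveI : NeZero (boxN R) := neZero_boxN R
  subst hD hTH hTE ho
  have hR : 1 ≤ R := le_trans (Nat.le_add_left 1 r) hrR
  have hrle : r ≤ R := le_trans (Nat.le_succ r) hrR
  have hz : (0 : Site 2) ∈ boxW R := zero_mem_boxW R
  have h1 : (1 : DihedralGroup 4) ∈ (Finset.univ : Finset (DihedralGroup 4)) := Finset.mem_univ _
  have hmul : ∀ a ∈ (Finset.univ : Finset (DihedralGroup 4)), ∀ b ∈ (Finset.univ : Finset (DihedralGroup 4)),
      a * b ∈ (Finset.univ : Finset (DihedralGroup 4)) := fun _ _ _ _ => Finset.mem_univ _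
  have hΛ : boxW r ⊆ boxW R := boxW_mono hrle
  have h8 : thicken (boxW r) 1 ⊆ boxW R := thicken_boxW_subset_boxW hrR
  have h0 : thicken ({0} : Finset (Site 2)) 1 ⊆ boxW R := thicken01_subset_boxW hR
  have ho' : ∀ σ : Fin 2, boxD R ((fun σ => orb (boxIx R 0) σ) σ) = orb (PolySite.pt 0 hz) σ := fun σ => boxD_orb_boxIx_zero R σ
  have hix0 : ∀ v ∈ thicken ({0} : Finset (Site 2)) 1, boxXs R (boxIx R v) = v := fun v hv => boxXs_boxIx R v (h0 hv)
  have hokS : ∀ (γc : Fin 8) (v : ℤ × ℤ), (boxQuot r R vmax).ok γc v = true → d4OfCode γc ∈ (Finset.univ : Finset (DihedralGroup 4)) :=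
    fun _ _ _ => Finset.mem_univ _
  have hokV : ∀ (γc : Fin 8) (v : ℤ × ℤ), (boxQuot r R vmax).ok γc v = true → ∀ j : Fin (boxN r),
      (boxQuot r R vmax).xs ((boxQuot r R vmax).ix (d4Vec (d4OfCode γc) ((boxQuot r R vmax).xsβ j) + siteOfPair v)) =
        d4Vec (d4OfCode γc) ((boxQuot r R vmax).xsβ j) + siteOfPair v :=
    fun γc v h j => box_hokV hv γc v h j
  have hH : termOp (boxD R) (hamTermsBox R 1 tp U) = (hubbardTTPrimeFermionInteraction 1 (tp : ℝ) (U : ℝ)).localHamiltonian (boxW R) := by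
    rw [termOp_hamTermsBox, Rat.cast_one]
  have hE : termOp (boxD R) (energyTermsIdx 1 tp U (boxIx R)) =
      fermionEmbed (PolySite.incl h0) ((hubbardTTPrimeFermionInteraction 1 (tp : ℝ) (U : ℝ)).meanEnergyObs 1) := by
    have h := termOp_energyTermsIdx (N := boxN R) 1 tp U (boxXs R) (boxXs_mem R) h0 (boxIx R) hix0 (boxD R) (boxD_orb R)
    rw [Rat.cast_one] at h
    exact h
  exact affineOrbitLowerRowN_of_quotAdjChainKernelCertTBRowsHalfAuto tp U hU hΛ h8 h0 hz h1 hmul (boxQuot r R vmax) (boxXs_mem R)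
    (boxXs_boxIx R) (boxXs_mem r) (boxQuot_hcovβ r R vmax) (boxD R) (boxD_injective R) (boxD_orb R) Bkey (boxD r) (boxQuot_hdΛ r R vmax)
    (boxD_boxPush hrle) (fun p => (ofLex p).2) (boxD_spin R) hokS hokV (hamTermsBox R 1 tp U) hH (energyTermsIdx 1 tp U (boxIx R)) hE
    (fun σ => orb (boxIx R 0) σ) ho' TX μ ν κhi hi κlo lo K blocks EB CW hcw AV ns M Cs hC0 Hs hchain hs hq

/-- **SINGLE-VERTEX CLOSER AT BOX GEOMETRY, FULL-ROW GRAM** (`gramTBRows`), otherwise as above. [cite: WangEtAl2024, §III]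
[cite: Han2020Bootstrap, §3] [cite: JanssonChaykinKeil2008, §3] -/
theorem affineOrbitLowerRowN_of_chainTBRowsAuto_box (r R vmax : ℕ) (hrR : r + 1 ≤ R) (hv : r + vmax ≤ R)
    (tp U : ℚ) (hU : 0 ≤ U) (Bkey : ℕ)
    (D : QuotData (boxN R) (boxN r)) (hD : D = boxQuot r R vmax)
    (TH : Terms (Orb (Fin (boxN R)))) (hTH : TH = hamTermsBox R 1 tp U)
    (TE : Terms (Orb (Fin (boxN R)))) (hTE : TE = energyTermsIdx 1 tp U (boxIx R))
    (o : Fin 2 → Orb (Fin (boxN R))) (ho : o = fun σ => orb (boxIx R 0) σ)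
    (TX : Terms (Orb (Fin (boxN R)))) (μ : Fin 2 → ℚ) (ν κhi hi κlo lo : ℚ) (K : ℕ)
    (blocks : List (List (List ℤ × Terms (Orb (Fin (boxN R)))))) (EB : List (Terms (Orb (Fin (boxN r)))))
    (CW : Terms (Orb (Fin (boxN R)))) (hcw : ∀ wc ∈ CW, chargeW wc.1 ≠ 0 ∨ spinChargeW (fun p => (ofLex p).2) wc.1 ≠ 0)
    (AV : List (Terms (Orb (Fin (boxN R)))))
    (ns : List ℕ) (M : ℕ) (Cs : List SOSDual.EncPoly) (hC0 : Cs.getD 0 [] = []) (Hs : List (List (QHint (boxN r))))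
    (hchain : ChainQAOK D Bkey M Cs
      (groupSlices (residTGslicesNear TX μ ν o κhi hi κlo lo TE (gramTBRows K blocks) TH D.f EB (autoMasks TH D.f EB)
        (fun l : Fin 0 => l.elim0) (fun l : Fin 0 => l.elim0) CW AV) ns) Hs)
    {q s n₀ : ℚ} (hs : s = (μ 0 + μ 1) / 2)
    (hq : haveI := neZero_boxN R; q ≤ lowerConst (SOSDual.decPoly (boxN R) (Cs.getD M [])) + (μ 0 + μ 1) * (n₀ / 2 - ν)) :
    SquareTTPrimeCorrAffineOrbitLowerRowN (tp : ℝ) (U : ℝ) q hi lo κhi κlo s n₀ Finset.univ (boxW R) (termOp (boxD R) TX) := by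
  haveI : NeZero (boxN R) := neZero_boxN R
  subst hD hTH hTE ho
  have hR : 1 ≤ R := le_trans (Nat.le_add_left 1 r) hrR
  have hrle : r ≤ R := le_trans (Nat.le_succ r) hrR
  have hz : (0 : Site 2) ∈ boxW R := zero_mem_boxW R
  have h1 : (1 : DihedralGroup 4) ∈ (Finset.univ : Finset (DihedralGroup 4)) := Finset.mem_univ _
  have hmul : ∀ a ∈ (Finset.univ : Finset (DihedralGroup 4)), ∀ b ∈ (Finset.univ : Finset (DihedralGroup 4)),
      a * b ∈ (Finset.univ : Finset (DihedralGroup 4)) := fun _ _ _ _ => Finset.mem_univ _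
  have hΛ : boxW r ⊆ boxW R := boxW_mono hrle
  have h8 : thicken (boxW r) 1 ⊆ boxW R := thicken_boxW_subset_boxW hrR
  have h0 : thicken ({0} : Finset (Site 2)) 1 ⊆ boxW R := thicken01_subset_boxW hR
  have ho' : ∀ σ : Fin 2, boxD R ((fun σ => orb (boxIx R 0) σ) σ) = orb (PolySite.pt 0 hz) σ := fun σ => boxD_orb_boxIx_zero R σ
  have hix0 : ∀ v ∈ thicken ({0} : Finset (Site 2)) 1, boxXs R (boxIx R v) = v := fun v hv => boxXs_boxIx R v (h0 hv)
  have hokS : ∀ (γc : Fin 8) (v : ℤ × ℤ), (boxQuot r R vmax).ok γc v = true → d4OfCode γc ∈ (Finset.univ : Finset (DihedralGroup 4)) :=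
    fun _ _ _ => Finset.mem_univ _
  have hokV : ∀ (γc : Fin 8) (v : ℤ × ℤ), (boxQuot r R vmax).ok γc v = true → ∀ j : Fin (boxN r),
      (boxQuot r R vmax).xs ((boxQuot r R vmax).ix (d4Vec (d4OfCode γc) ((boxQuot r R vmax).xsβ j) + siteOfPair v)) =
        d4Vec (d4OfCode γc) ((boxQuot r R vmax).xsβ j) + siteOfPair v :=
    fun γc v h j => box_hokV hv γc v h j
  have hH : termOp (boxD R) (hamTermsBox R 1 tp U) = (hubbardTTPrimeFermionInteraction 1 (tp : ℝ) (U : ℝ)).localHamiltonian (boxW R) := by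
    rw [termOp_hamTermsBox, Rat.cast_one]
  have hE : termOp (boxD R) (energyTermsIdx 1 tp U (boxIx R)) =
      fermionEmbed (PolySite.incl h0) ((hubbardTTPrimeFermionInteraction 1 (tp : ℝ) (U : ℝ)).meanEnergyObs 1) := by
    have h := termOp_energyTermsIdx (N := boxN R) 1 tp U (boxXs R) (boxXs_mem R) h0 (boxIx R) hix0 (boxD R) (boxD_orb R)
    rw [Rat.cast_one] at h
    exact h
  exact affineOrbitLowerRowN_of_quotAdjChainKernelCertGAuto tp U hU hΛ h8 h0 hz h1 hmul (boxQuot r R vmax) (boxXs_mem R)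
    (boxXs_boxIx R) (boxXs_mem r) (boxQuot_hcovβ r R vmax) (boxD R) (boxD_injective R) (boxD_orb R) Bkey (boxD r) (boxQuot_hdΛ r R vmax)
    (boxD_boxPush hrle) (fun p => (ofLex p).2) (boxD_spin R) hokS hokV (hamTermsBox R 1 tp U) hH (energyTermsIdx 1 tp U (boxIx R)) hE
    (fun σ => orb (boxIx R 0) σ) ho' TX μ ν κhi hi κlo lo (gramTBRows K blocks) (gramTBCoef_posSemidef K blocks) (gramTBOp (boxD R) blocks)
    (termOp_flatten_gramTBRows (boxD R) K blocks) EB CW hcw AV ns M Cs hC0 Hs hchain hs hq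

end BoxCloser

end CARPolyWindow

end Summit.Ventures.CertifiedManyBodySolver
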